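import Literature.Geometry.Lorentzian.KerrConvergence
import Summits.FinalStateConjecture.FinalStateConjecture.Theorems.EIHFluxBalanceInertialRecessionLorentz

/-!
# Route ClusterCompleteness — crux `AdiabaticMultiKerrILED`, line `Sketch`: zone kinematics

Helper file for the crux `stmt-FinalStateConjecture-14310`
(`Summit.FinalStateConjecture.FinalStateConjecture.Theses.ClusterCompleteness.AdiabaticMultiKerrILED`).

A hole in inertial motion `(Λ, p)` has `4`-velocity `u = Λ e₀` (`γ = u⁰`), lab velocity
`v = u⃗ / u⁰`, and rest-frame coordinates `q x = Λ⁻¹ (x − (0, p))` of the lab point `x`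
(`poincareInv`). For the lab point `(t, y)` put `d = y − p − t v` (lab displacement from the moving
centre) and `z⃗ = spatial (q (t, y))` (rest-frame spatial position). The **Lorentz-contraction
sandwich** `|d|² ≤ |z⃗|² ≤ γ² |d|²` (`stub_zoneKinematics`) follows from the identity
`|z⃗|² = |d|² + ⟨u⃗, d⟩²` (`spatialNorm_sq_lorentz_symm`), itself a consequence of the
`η`-invariance of `Λ⁻¹` (`η(z, z) = η(w, w)`, `η(e₀, z) = η(u, w)`, `η(u, u) = −1`, where
`w = (t, y) − (0, p)` and `z = Λ⁻¹ w`), and of Cauchy–Schwarz `⟨u⃗, d⟩² ≤ |u⃗|² |d|² = (γ² − 1) |d|²`.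
The time/space bookkeeping of `η` and the Lorentz-factor identity `(u⁰)² = 1 + |u⃗|²` are taken from
`Theorems/EIHFluxBalanceInertialRecessionLorentz.lean`. Special relativity folklore (O'Neill 1983,
Ch. 9, pp. 233–236). [folklore]
-/

noncomputable section

-- the doubled `FinalStateConjecture.FinalStateConjecture` path component trips dupNamespace
set_option linter.dupNamespace false

open scoped InnerProductSpace
open Literature.Geometry.Lorentzian

namespace Summit.FinalStateConjecture.FinalStateConjecture.Cruxes.AdiabaticMultiKerrILED.Sketch

/-- A `4`-velocity `u = Λ e₀` is unit timelike: `|u⃗|² = (u⁰)² − 1` (O'Neill 1983, Ch. 9, p. 233;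
`Theorems.lorentz_apply_zero_sq`). [folklore] -/
theorem spatialNorm_sq_fourVelocity (Λ : lorentzGroup) {u : E4}
    (hu : u = (Λ : E4 ≃L[ℝ] E4) (E4.basisVector 0)) :
    E4.spatialNorm u ^ 2 = (u 0) ^ 2 - 1 := by
  have h := Theorems.lorentz_apply_zero_sq Λ
  rw [← hu] at h
  linarith

/-- **Rest-frame spatial radius** of a lab vector: if `u = Λ e₀` and `w⁰ = c u⁰`, then
`|spatial (Λ⁻¹ w)|² = |d|² + ⟨u⃗, d⟩²` with `d = w⃗ − c u⃗` (the component of `d` along the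
motion is dilated by `γ² = 1 + |u⃗|²`, the transverse ones are unchanged; O'Neill 1983, Ch. 9,
Lorentz contraction). Proof: `η(Λ⁻¹w, Λ⁻¹w) = η(w, w)`, `(Λ⁻¹w)⁰ = −η(e₀, Λ⁻¹w) = −η(u, w)`,
`η(u, u) = −1`, then algebra. [folklore] -/
theorem spatialNorm_sq_lorentz_symm (Λ : lorentzGroup) {u : E4}
    (hu : u = (Λ : E4 ≃L[ℝ] E4) (E4.basisVector 0)) (w : E4) (c : ℝ) (hc : w 0 = c * u 0) :
    E4.spatialNorm ((Λ : E4 ≃L[ℝ] E4).symm w) ^ 2 =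
      ‖E4.spatial w - c • E4.spatial u‖ ^ 2 +
        ⟪E4.spatial u, E4.spatial w - c • E4.spatial u⟫_ℝ ^ 2 := by
  -- `Λ⁻¹ ∈ O(1,3)` preserves `η` (a subgroup is closed under inverses)
  have hinv : ∀ v v' : E4,
      Minkowski.bilin ((Λ : E4 ≃L[ℝ] E4).symm v) ((Λ : E4 ≃L[ℝ] E4).symm v') =
        Minkowski.bilin v v' := fun v v' => (lorentzGroup.inv_mem Λ.2) v v'
  -- `η(u, w) = −u⁰ w⁰ + ⟨u⃗, w⃗⟩`
  have huw : Minkowski.bilin u w = -(u 0 * w 0) + ⟪E4.spatial u, E4.spatial w⟫_ℝ := by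
    rw [Minkowski.bilin_apply, PiLp.inner_apply]
    congr 1
    refine Finset.sum_congr rfl fun i _ => ?_
    simp [E4.spatial_apply, mul_comm]
  -- the three invariance facts, in components
  have hA := hinv w w
  rw [Theorems.minkowski_bilin_self, Theorems.minkowski_bilin_self, hc] at hA
  have he : (Λ : E4 ≃L[ℝ] E4).symm u = E4.basisVector 0 := by
    rw [hu, ContinuousLinearEquiv.symm_apply_apply]
  have hB := hinv u w
  rw [he, Minkowski.bilin_basisVector_zero_left, huw, hc] at hB
  have hN := spatialNorm_sq_fourVelocity Λ hu
  -- decompose `w⃗ = d + c u⃗`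
  have had : E4.spatial w = (E4.spatial w - c • E4.spatial u) + c • E4.spatial u :=
    (sub_add_cancel _ _).symm
  have hD : E4.spatialNorm w ^ 2 = ‖E4.spatial w - c • E4.spatial u‖ ^ 2 +
      2 * (c * ⟪E4.spatial u, E4.spatial w - c • E4.spatial u⟫_ℝ) +
        c ^ 2 * E4.spatialNorm u ^ 2 := by
    rw [E4.spatialNorm, E4.spatialNorm]
    conv_lhs => rw [had]
    rw [norm_add_sq_real, real_inner_smul_right, real_inner_comm (E4.spatial u), norm_smul,
      mul_pow, Real.norm_eq_abs, sq_abs]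
  have hP : ⟪E4.spatial u, E4.spatial w⟫_ℝ =
      ⟪E4.spatial u, E4.spatial w - c • E4.spatial u⟫_ℝ + c * E4.spatialNorm u ^ 2 := by
    conv_lhs => rw [had]
    rw [inner_add_right, real_inner_smul_right, real_inner_self_eq_norm_sq, E4.spatialNorm]
  -- scalar algebra
  have hS : E4.spatialNorm ((Λ : E4 ≃L[ℝ] E4).symm w) ^ 2 =
      ((Λ : E4 ≃L[ℝ] E4).symm w) 0 ^ 2 - (c * u 0) ^ 2 + E4.spatialNorm w ^ 2 := by
    linarith
  have hz0 : ((Λ : E4 ≃L[ℝ] E4).symm w) 0 =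
      u 0 * (c * u 0) - ⟪E4.spatial u, E4.spatial w⟫_ℝ := by
    linarith
  rw [hS, hz0, hP, hD, hN]
  ring

/-- **Zone kinematics** (Lorentz contraction sandwich): for a hole in inertial motion `(Λ, p)` with
`u = Λ e₀` future-directed, the rest-frame spatial position `z⃗ = spatial (Λ⁻¹((t, y) − (0, p)))` of the
lab point `(t, y)` satisfies `|d|² ≤ |z⃗|² ≤ (u⁰)² |d|²`, `d = y − p − t v`, `v = u⃗/u⁰`
(`|z⃗|² = |d|² + (u⁰)²⟨d, v⟩²` and Cauchy–Schwarz; O'Neill 1983, Ch. 9). [folklore] -/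
theorem stub_zoneKinematics :
    ∀ (Λ : lorentzGroup) (p : E3) (u : E4) (q : E4 → E4),
      u = (Λ : E4 ≃L[ℝ] E4) (E4.basisVector 0) →
      (∀ x, q x = poincareInv Λ (E4.ofTimeSpace 0 p) x) → 0 < u 0 →
      ∀ (t : ℝ) (y : E3),
        ‖y - p - (t * (u 0)⁻¹) • E4.spatial u‖ ^ 2 ≤ E4.spatialNorm (q (E4.ofTimeSpace t y)) ^ 2 ∧
        E4.spatialNorm (q (E4.ofTimeSpace t y)) ^ 2 ≤
          (u 0) ^ 2 * ‖y - p - (t * (u 0)⁻¹) • E4.spatial u‖ ^ 2 := by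
  intro Λ p u q hu hq hγ t y
  have hz : q (E4.ofTimeSpace t y) =
      (Λ : E4 ≃L[ℝ] E4).symm (E4.ofTimeSpace t y - E4.ofTimeSpace 0 p) := by
    rw [hq, poincareInv]
  have hc : (E4.ofTimeSpace t y - E4.ofTimeSpace 0 p) 0 = t * (u 0)⁻¹ * u 0 := by
    rw [inv_mul_cancel_right₀ hγ.ne']
    simp
  have hws : E4.spatial (E4.ofTimeSpace t y - E4.ofTimeSpace 0 p) = y - p := by
    rw [map_sub, E4.spatial_ofTimeSpace, E4.spatial_ofTimeSpace]
  -- `|z⃗|² = |d|² + ⟨u⃗, d⟩²`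
  have hS := spatialNorm_sq_lorentz_symm Λ hu _ _ hc
  rw [hws, ← hz] at hS
  -- Cauchy–Schwarz `⟨u⃗, d⟩² ≤ |u⃗|² |d|² = ((u⁰)² − 1) |d|²`
  have hN := spatialNorm_sq_fourVelocity Λ hu
  rw [E4.spatialNorm] at hN
  have hCS := real_inner_mul_inner_self_le (E4.spatial u) (y - p - (t * (u 0)⁻¹) • E4.spatial u)
  rw [real_inner_self_eq_norm_sq, real_inner_self_eq_norm_sq, hN] at hCS
  constructor
  · rw [hS]
    nlinarith [sq_nonneg ⟪E4.spatial u, y - p - (t * (u 0)⁻¹) • E4.spatial u⟫_ℝ]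
  · rw [hS]
    nlinarith [hCS]

end Summit.FinalStateConjecture.FinalStateConjecture.Cruxes.AdiabaticMultiKerrILED.Sketch

end
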